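/-
Copyright (c) 2026. All rights reserved.
Released under Apache 2.0 license as described in the file LICENSE.
Authors: abc-iut cell, statement-typer seat abc-iut-L4-t3 (wave 1).
-/
import Literature.AnabelianGeometry.AbsoluteAnabelian.LogFrobeniusRigidity
import HarnessLib

/-!
# [AbsTopIII] Corollary 5.5 (iii), `TS`-valued half, and Corollary 5.5 (iv), first sentence in full: the observable `S_log` and the log-wall

S. Mochizuki, *Topics in absolute anabelian geometry III: global reconstruction algorithms*,
J. Math. Sci. Univ. Tokyo 22 (2015) 939–1156 [MochizukiAbsTopIII2015]; locators `p.N` = pages of the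
author's manuscript (`paper:url-5493eb38cbb7`), read on the page: Def 5.4 (vii) p. 128 (`ι_{v,ε}`), Cor 5.5 (iii), (iv)
p. 131.

Completion of `LogFrobeniusCorollaries.lean` (seat abc-iut-L4-t3), which typed the `⊞`-half `S_log⊞` of Cor 5.5 (iii) and,
accordingly, Cor 5.5 (iv) against `S_log⊞` only (disclosed there as formally STRONGER than print, referee K1-F1). Here:
* Def 5.4 (vii), `TS`-valued half — the natural transformations `ι_{v,ε} : λ_{v,ν₁} ∘ Λ_{ν₁} → λ_{v,ν₂}` for EVERY edge `ε` of
  `Γ⃗^log_v` (`λ_{v,ν} = λ⊞_{v,ν}` composed with `𝒩⊞_v → 𝒩_v`): the INTERFACE `LogFrobeniusSetting.TSHomotopies L` (one extra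
  datum beyond `L.iota` — at the arrows of `Γ⃗^log_v` not in `Γ⃗^⋉_v`, i.e. the space-link arrow `k̄^× ↪ k̄` at nonarchimedean
  `v` — together with the requirement that on `Γ⃗^⋉_v` it is `ι⊞_{v,ε}` pushed down to `𝒩_v`);
* Cor 5.5 (iii), `TS`-half (paraphrase of the "respectively" reading of p. 131: the `ι_{v,ε}` belong to a family of
  homotopies on `D•_{≤4}` that determines on the portion of `D•_{≤4}` indexed by `v` a structure of observable `S_log` on the
  portion of `D•_{≤3}` indexed by `v`) = `IsLogObservableTS` / `Cor55ObservablesTS`; "the families of homotopies that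
  constitute `S_log` and `S_log⊞` are compatible with one another as well as with the families of homotopies that
  constitute the core and telecore structures of (i), (ii)" = `Cor55ObservablesCompatible` for the core part (compatibility
  with the telecore family of (ii) is not typed — TODO(general form), as in `LogFrobeniusCorollaries.lean`);
* Cor 5.5 (iv), first sentence, PRINT-FAITHFUL: "`D•_{≤2}` does not admit a structure of core on `D•_{≤1}` which [i.e., whose
  constituent family of homotopies] is compatible with [the constituent families of homotopies of] the observables
  `S_log`, `S_log⊞` of (iii)" = `Cor55LogWall` (both observables; `Cor55Incompatibility` of `LogFrobeniusCorollaries.lean`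
  is the `S_log⊞`-only, formally stronger variant). The second sentence of (iv) (`𝔗_{An•}`, `ℋ_{An•}` and the observables
  not simultaneously compatible) needs the contact structure with PINNED generators `η_{□⋎}`, `η_⋏`; it stays
  TODO(general form).
Every `Prop` is an ASSUMPTION on `(L, T)` asserted by the text for the genuine theaters. Refereed pre-IUT material;
nothing here bears on [IUTchIII] Cor. 3.12; typed ≠ discharged.
-/

set_option autoImplicit false

universe u

open CategoryTheory Quiver

namespace Literature.AnabelianGeometry.AbsoluteAnabelian

variable {Vmod : Type u} {isArc : Vmod → Bool}

/-! ## Def 5.4 (vii), `TS`-half: `ι_{v,ε}` for every edge of `Γ⃗^log_v` -/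

/-- all the edges of `Γ⃗^log_v` (archimedean or nonarchimedean according to `v`) — the index set of the `TS`-valued
`ι_{v,ε}` of Def 5.4 (vii) ("respectively, `Γ⃗^log_v`"). [cite: MochizukiAbsTopIII2015, Def 5.4 (vii) p. 128] -/
def LogEdgeTS : (b : Bool) → LogVertex b → LogVertex b → Type
  | true, ν₁, ν₂ => ArchEdge ν₁ ν₂
  | false, ν₁, ν₂ => NonarchEdge ν₁ ν₂

/-- an edge of `Γ⃗^⋉_v` is an edge of `Γ⃗^log_v`. [cite: MochizukiAbsTopIII2015, Def 5.4 (vii) p. 128] -/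
def LogEdge.toTS : {b : Bool} → {ν₁ ν₂ : LogVertex b} → LogEdge b ν₁ ν₂ → LogEdgeTS b ν₁ ν₂
  | true, _, _, ε => ε
  | false, _, _, ε => ε.1

namespace LogFrobeniusSetting

variable (L : LogFrobeniusSetting Vmod isArc)

/-- INTERFACE (Def 5.4 (vii), `TS`-valued half): "the arrow in the diagram of (iii) (respectively, (v)) corresponding to
`ε` determines a natural transformation … `ι_{v,ε} : λ_{v,ν₁} ∘ Λ_{ν₁} → λ_{v,ν₂}`" for every edge `ε` of `Γ⃗^log_v`, where
`λ_{v,ν}` is `λ⊞_{v,ν}` composed with `𝒩⊞_v → 𝒩_v` (Def 5.4 (iv), (vi)); on the edges of `Γ⃗^⋉_v` it is `ι⊞_{v,ε}` pushed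
down to `𝒩_v`. [cite: MochizukiAbsTopIII2015, Def 5.4 (vii) p. 128] -/
structure TSHomotopies : Type (u + 1) where
  /-- `ι_{v,ε}` for every edge `ε : ν₁ → ν₂` of `Γ⃗^log_v` -/
  iota : ∀ (v : Vmod) {ν₁ ν₂ : LogVertex (isArc v)}, LogEdgeTS (isArc v) ν₁ ν₂ →
    ((frobeniusTwist L.log ν₁.isPostLog ⋙ L.lam v ν₁) ⋙ L.forget v ⟶ L.lam v ν₂ ⋙ L.forget v)
  /-- on `Γ⃗^⋉_v`, `ι_{v,ε}` is `ι⊞_{v,ε}` composed with `𝒩⊞_v → 𝒩_v` -/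
  iota_toTS : ∀ (v : Vmod) {ν₁ ν₂ : LogVertex (isArc v)} (ε : LogEdge (isArc v) ν₁ ν₂),
    iota v ε.toTS = Functor.whiskerRight (L.iota v ε) (L.forget v)

/-! ## Cor 5.5 (iii), `TS`-half: the observable `S_log` at `v` -/

/-- "the portion of `D•_{≤3}` indexed by `v`": the vertices of `D•_{≤2}` together with `𝒩⊞_v`.
[cite: MochizukiAbsTopIII2015, Cor 5.5 (iii) p. 131] -/
def InPortionThree (v : Vmod) (x : DVertex Vmod isArc) : Prop := x.InFirstRows 2 ∨ x = .nplus v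

/-- `□` lies in the portion. [cite: MochizukiAbsTopIII2015, Cor 5.5 (iii) p. 131] -/
theorem core_mem_portion (v : Vmod) : InPortionThree (isArc := isArc) v .core := Or.inl core_mem_two

/-- `𝒳_n` lies in the portion. [cite: MochizukiAbsTopIII2015, Cor 5.5 (iii) p. 131] -/
theorem row1_mem_portion (v : Vmod) (n : ℤ) : InPortionThree (isArc := isArc) v (.row1 n) := Or.inl (row1_mem_two n)

/-- `𝒩⊞_v` lies in the portion. [cite: MochizukiAbsTopIII2015, Cor 5.5 (iii) p. 131] -/
theorem nplus_mem_portion (v : Vmod) : InPortionThree (isArc := isArc) v (.nplus v) := Or.inr rfl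

/-- the shape of `S_log` at `v`: the portion of `D•_{≤3}` indexed by `v`, with observation vertex `𝒩_v`.
[cite: MochizukiAbsTopIII2015, Cor 5.5 (iii) p. 131] -/
abbrev logShapeTS (v : Vmod) : ExtShape.{u} (DSub (InPortionThree (isArc := isArc) v)) :=
  obsShape (InPortionThree v) (.nv v)

/-- the extended diagram carrying `S_log` at `v`. [cite: MochizukiAbsTopIII2015, Cor 5.5 (iii) p. 131] -/
abbrev logDiagramTS (v : Vmod) :=
  (L.subdiagram (InPortionThree v)).extend (L.obsExt (InPortionThree v) (.nv v))

/-- the arrow `λ⊞_{v,ν} : □ → 𝒩⊞_v` inside the portion (`ν` pre-log). [cite: MochizukiAbsTopIII2015, Cor 5.5 p. 130] -/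
def lamEdgeTS (v : Vmod) (ν : LogVertex (isArc v)) (hν : ν.isPostLog = false) :
    ((logShapeTS (isArc := isArc) v).base ⟨.core, core_mem_portion v⟩ ⟶
      (logShapeTS (isArc := isArc) v).base ⟨.nplus v, nplus_mem_portion v⟩) :=
  DEdge.lam v ν hν

/-- the observation edge `𝒩⊞_v → 𝒩_v` of `S_log`. [cite: MochizukiAbsTopIII2015, Cor 5.5 (iii) p. 131] -/
def forgetEdgeTS (v : Vmod) :
    ((logShapeTS (isArc := isArc) v).base ⟨.nplus v, nplus_mem_portion v⟩ ⟶ (logShapeTS (isArc := isArc) v).obs) :=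
  DEdge.forget v

/-- `id_⋎ : 𝒳_⋎ → □` inside the portion. [cite: MochizukiAbsTopIII2015, Cor 5.5 p. 130] -/
def toCoreEdgeTS (v : Vmod) (n : ℤ) :
    ((logShapeTS (isArc := isArc) v).base ⟨.row1 n, row1_mem_portion v n⟩ ⟶
      (logShapeTS (isArc := isArc) v).base ⟨.core, core_mem_portion v⟩) :=
  DEdge.toCore n

/-- `log : 𝒳_{⋎+1} → 𝒳_⋎` inside the portion. [cite: MochizukiAbsTopIII2015, Cor 5.5 p. 130] -/
def logEdgeTS (v : Vmod) (n : ℤ) :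
    ((logShapeTS (isArc := isArc) v).base ⟨.row1 (n + 1), row1_mem_portion v (n + 1)⟩ ⟶
      (logShapeTS (isArc := isArc) v).base ⟨.row1 n, row1_mem_portion v n⟩) :=
  DEdge.log n

/-- the path `[𝒩⊞_v → 𝒩_v] ∘ [λ⊞_{v,ν}]` of length 2 from `□` to `𝒩_v` (the arrow `λ_{v,ν}` "associated to the path of length 2
from the second to the fourth row"). [cite: MochizukiAbsTopIII2015, Cor 5.5 (iii) p. 131] -/
def lamPathTS (v : Vmod) (ν : LogVertex (isArc v)) (hν : ν.isPostLog = false) :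
    Path ((logShapeTS (isArc := isArc) v).base ⟨.core, core_mem_portion v⟩) (logShapeTS (isArc := isArc) v).obs :=
  (Path.nil.cons (lamEdgeTS v ν hν)).cons (forgetEdgeTS v)

/-- the path of length 4 from `𝒳_{⋎+1}` to `𝒩_v` through `log`, `id_⋎` and the space-link functor (domain of `ι_{v,ε}` for `ε`
leaving the post-log vertex). [cite: MochizukiAbsTopIII2015, Cor 5.5 (iii) p. 131] -/
def postLogDomPathTS (v : Vmod) (n : ℤ) (hsl : (LogVertex.spaceLink (isArc v)).isPostLog = false) :
    Path ((logShapeTS (isArc := isArc) v).base ⟨.row1 (n + 1), row1_mem_portion v (n + 1)⟩)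
      (logShapeTS (isArc := isArc) v).obs :=
  ((((Path.nil.cons (logEdgeTS v n)).cons (toCoreEdgeTS v n)).cons (lamEdgeTS v _ hsl)).cons (forgetEdgeTS v))

/-- the path of length 3 from `𝒳_{⋎+1}` to `𝒩_v` through `id_{⋎+1}` and `λ⊞_{v,ν₂}` (codomain of such an `ι_{v,ε}`).
[cite: MochizukiAbsTopIII2015, Cor 5.5 (iii) p. 131] -/
def postLogCodPathTS (v : Vmod) (n : ℤ) (ν : LogVertex (isArc v)) (hν : ν.isPostLog = false) :
    Path ((logShapeTS (isArc := isArc) v).base ⟨.row1 (n + 1), row1_mem_portion v (n + 1)⟩)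
      (logShapeTS (isArc := isArc) v).obs :=
  (((Path.nil.cons (toCoreEdgeTS v (n + 1))).cons (lamEdgeTS v ν hν)).cons (forgetEdgeTS v))

/-- paraphrase of Cor 5.5 (iii) p. 131 ("respectively" reading): the `ι_{v,ε}` belong to a family of homotopies that
determines on the portion of `D•_{≤4}` indexed by `v` a structure of observable `S_log` on the portion of `D•_{≤3}` indexed by
`v` — as the predicate on a family of homotopies `H` of the extended diagram: (1) all boundary paths end at `𝒩_v`; (2) for every edge `ε : ν₁ → ν₂` of `Γ⃗^log_v` with `ν₁` pre-log the pair
`([λ_{v,ν₁}], [λ_{v,ν₂}])` is a boundary pair whose homotopy is `ι_{v,ε}` (componentwise); (3) for `ε` leaving the post-log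
vertex and every `⋎ ∈ L` the pair (`[λ_{v,space-link}] ∘ [id_⋎] ∘ [log]`, `[λ_{v,ν₂}] ∘ [id_{⋎+1}]`) is a boundary pair whose
homotopy is `ι_{v,ε}`. [cite: MochizukiAbsTopIII2015, Cor 5.5 (iii) p. 131] -/
def IsLogObservableTS (T : L.TSHomotopies) (v : Vmod) (H : (L.logDiagramTS v).HomotopyFamily) : Prop :=
  (∀ ⦃a b : (logShapeTS (isArc := isArc) v).Vertex⦄ ⦃p q : Path a b⦄, H.E p q →
      b = (logShapeTS (isArc := isArc) v).obs) ∧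
  (∀ (ν₁ ν₂ : LogVertex (isArc v)) (ε : LogEdgeTS (isArc v) ν₁ ν₂) (h₁ : ν₁.isPostLog = false)
      (h₂ : ν₂.isPostLog = false),
    ∃ hmem : H.E (lamPathTS v ν₁ h₁) (lamPathTS v ν₂ h₂),
      ∀ X₀ : L.X, ∃ (hobj : ((L.logDiagramTS v).pathFunctor (lamPathTS v ν₁ h₁)).obj X₀ =
          ((frobeniusTwist L.log ν₁.isPostLog ⋙ L.lam v ν₁) ⋙ L.forget v).obj X₀)
        (hobj' : (L.lam v ν₂ ⋙ L.forget v).obj X₀ = ((L.logDiagramTS v).pathFunctor (lamPathTS v ν₂ h₂)).obj X₀),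
        (H.η hmem).app X₀ = eqToHom hobj ≫ (T.iota v ε).app X₀ ≫ eqToHom hobj') ∧
  (∀ (ν₁ ν₂ : LogVertex (isArc v)) (ε : LogEdgeTS (isArc v) ν₁ ν₂) (h₁ : ν₁.isPostLog = true)
      (h₂ : ν₂.isPostLog = false) (hsl : (LogVertex.spaceLink (isArc v)).isPostLog = false) (n : ℤ),
    ∃ hmem : H.E (postLogDomPathTS v n hsl) (postLogCodPathTS v n ν₂ h₂),
      ∀ X₀ : L.X, ∃ (hobj : ((L.logDiagramTS v).pathFunctor (postLogDomPathTS v n hsl)).obj X₀ =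
          ((frobeniusTwist L.log ν₁.isPostLog ⋙ L.lam v ν₁) ⋙ L.forget v).obj X₀)
        (hobj' : (L.lam v ν₂ ⋙ L.forget v).obj X₀ = ((L.logDiagramTS v).pathFunctor (postLogCodPathTS v n ν₂ h₂)).obj X₀),
        (H.η hmem).app X₀ = eqToHom hobj ≫ (T.iota v ε).app X₀ ≫ eqToHom hobj')

/-- **Cor 5.5 (iii), `TS`-half** (assumption on `(L, T)`): for each `v ∈ V(F_mod)` the `ι_{v,ε}` belong to a family of
homotopies determining an observable `S_log` on the portion of `D•_{≤3}` indexed by `v` (observation vertex `𝒩_v`).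
[cite: MochizukiAbsTopIII2015, Cor 5.5 (iii) p. 131] -/
def Cor55ObservablesTS (T : L.TSHomotopies) : Prop :=
  ∀ v : Vmod, ∃ H : (L.logDiagramTS v).HomotopyFamily, L.IsLogObservableTS T v H

/-- **Cor 5.5 (iii), last sentence** (assumption on `(L, T)`): "the families of homotopies that constitute `S_log` and
`S_log⊞` are compatible with one another as well as with the families of homotopies that constitute the core and telecore
structures of (i), (ii)" — typed for the cores: all embed into one family of homotopies on `D•⊢` (compatibility with the
telecore family of (ii): TODO(general form)). [cite: MochizukiAbsTopIII2015, Cor 5.5 (iii) p. 131] -/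
def Cor55ObservablesCompatible (T : L.TSHomotopies) : Prop :=
  ∃ K : L.diagram.HomotopyFamily, L.RealisesCor55Families K ∧
    ∀ v : Vmod, ∃ H : (L.logDiagramTS v).HomotopyFamily, L.IsLogObservableTS T v H ∧ L.CompatibleIn K H

/-! ## Cor 5.5 (iv), first sentence: the log-wall, against both observables -/

/-- **Cor 5.5 (iv), first sentence** (the LOG-WALL, print-faithful form; assumption on `(L, T)`): "`D•_{≤2}` does not admit a
structure of core on `D•_{≤1}` which [i.e., whose constituent family of homotopies] is compatible with [the constituent
families of homotopies of] the observables `S_log`, `S_log⊞` of (iii)" — no core structure on `D•_{≤1} ∪ {□}` embeds into one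
family of homotopies on `D•⊢` together with observables `S_log⊞` AND `S_log` at every `v`. [cite: MochizukiAbsTopIII2015, Cor 5.5 (iv) p. 131] -/
def Cor55LogWall (T : L.TSHomotopies) : Prop :=
  ¬ ∃ (Hc : ((L.subdiagram (DVertex.InFirstRows 1)).extend (L.obsExt (DVertex.InFirstRows 1) .core)).HomotopyFamily)
      (hHc : ∀ ⦃a b : (obsShape (DVertex.InFirstRows (isArc := isArc) 1) DVertex.core).Vertex⦄ ⦃p q : Path a b⦄,
        Hc.E p q → b = (obsShape (DVertex.InFirstRows (isArc := isArc) 1) DVertex.core).obs)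
      (K : L.diagram.HomotopyFamily) (Hplus : ∀ v : Vmod, (L.logDiagramPlus v).HomotopyFamily)
      (Hts : ∀ v : Vmod, (L.logDiagramTS v).HomotopyFamily),
    (DiagramOfCategories.Observable.mk _ (fun _ => (inferInstance : IsEmpty PEmpty.{u + 1})) _ Hc hHc).IsCore ∧
      L.CompatibleIn K Hc ∧
      ∀ v : Vmod, (L.IsLogObservablePlus v (Hplus v) ∧ L.CompatibleIn K (Hplus v)) ∧
        (L.IsLogObservableTS T v (Hts v) ∧ L.CompatibleIn K (Hts v))

/-- the print-faithful log-wall implies nothing weaker than — and is implied by — the `S_log⊞`-only form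
`Cor55Incompatibility` of `LogFrobeniusCorollaries.lean` (fewer compatibility constraints there): the latter is the
stronger statement. [cite: MochizukiAbsTopIII2015, Cor 5.5 (iv) p. 131] -/
theorem cor55LogWall_of_incompatibility (T : L.TSHomotopies) (h : L.Cor55Incompatibility) : L.Cor55LogWall T := by
  rintro ⟨Hc, hHc, K, Hplus, Hts, hcore, hcK, hv⟩
  exact h ⟨Hc, hHc, K, Hplus, hcore, hcK, fun v => (hv v).1⟩

end LogFrobeniusSetting

end Literature.AnabelianGeometry.AbsoluteAnabelian
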